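import Mathlib

/-!
# Crux `UniformPhotonSphereChannelsR` (K1R, stmt-FinalStateConjecture-14074), line
# `crum-peeling-recessive-tower` — stub (A2a) `stub_convolutionBounds`, part 1: basic sums, (CV3), (CV4)

Support file for the registered stub `stub_convolutionBounds` (five elementary inequalities for
the two-regime weight `ω_λ(m) := 1/(m(2λ−1+m))` of the uniform majorant induction, Theorem A of
the line).  Writing `L := 2λ − 1 ≥ 3`, this part provides (prefix `convolutionBounds_`):

* the telescoping sums `Σ_{i≥2} 1/i² ≤ 1`, `Σ_{i≥1} 1/(i(i+1)) ≤ 1` and the reflection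
  `i ↦ m − i` of sums over `1 ≤ i < m` (`2 ≤ i < m`);
* the logarithmic telescoping `Σ_{1≤i<m} 1/(i(L+i)) ≤ 1/(L+1) + log(L+1)/L` (`L > 0`), from
  `1/((y+1)(L+y+1)) ≤ (1/L)[(log(y+1) − log(L+y+1)) − (log y − log(L+y))]`, and the crude
  `Σ_{1≤i<m} 1/(i(L+i)) ≤ 1`;
* (CV4) `Σ_{i=2}^{n−1} i⁻²/(L+n−i) ≤ 3/(L+n)` — from `1/(L+n−i) = (1/(L+n))(1 + i/(L+n−i))` and
  `i(L+n−i) ≥ (4/3)(L+n)`;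
* (CV3) `n Σ_{i=1}^{n−1} i⁻¹ ω(n−i) ≤ 4` — from `1/(i(n−i)) = (1/n)(1/i + 1/(n−i))`,
  `i(L+n−i) ≥ n` and the reflected crude bound;
* the registered sub-goal `convolutionBounds_small` = (CV3) ∧ (CV4).

Part 2 (the stub itself) adds (CV1), (CV2) and the room inequality (G).
-/

-- `Summit.<S>.<S>` repeats a namespace component by design (D-0017); off here as in the lakefile.
set_option linter.dupNamespace false

noncomputable section

namespace Summit.FinalStateConjecture.FinalStateConjecture.Theorems.CrumPeelingRecessiveTower

open Finset

/-! ### Telescoping sums -/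

/-- `Σ_{i=2}^{N−1} 1/i² ≤ 1`, by the telescoping majorant `1/i² ≤ 1/(i−1) − 1/i`. -/
theorem convolutionBounds_sum_inv_sq_le_one (N : ℕ) :
    ∑ i ∈ Finset.Ico 2 N, (1 / ((i : ℝ) ^ 2)) ≤ 1 := by
  set f : ℕ → ℝ := fun k => 1 / ((k : ℝ) + 1) with hf
  have hle : ∀ k ∈ Finset.range (N - 2), (1 / (((2 + k : ℕ) : ℝ) ^ 2)) ≤ f k - f (k + 1) := by
    intro k _
    simp only [hf]
    push_cast
    have hk : (0 : ℝ) ≤ k := Nat.cast_nonneg k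
    rw [div_sub_div _ _ (by positivity) (by positivity),
      div_le_div_iff₀ (by positivity) (by positivity)]
    nlinarith
  calc ∑ i ∈ Finset.Ico 2 N, (1 / ((i : ℝ) ^ 2))
      = ∑ k ∈ Finset.range (N - 2), (1 / (((2 + k : ℕ) : ℝ) ^ 2)) :=
        Finset.sum_Ico_eq_sum_range _ 2 N
    _ ≤ ∑ k ∈ Finset.range (N - 2), (f k - f (k + 1)) := Finset.sum_le_sum hle
    _ = f 0 - f (N - 2) := Finset.sum_range_sub' f (N - 2)
    _ ≤ 1 := by
        have h0 : f 0 = 1 := by simp [hf]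
        have hN : 0 ≤ f (N - 2) := by simp only [hf]; positivity
        linarith

/-- `Σ_{i=1}^{N−1} 1/(i(i+1)) ≤ 1` (telescoping). -/
theorem convolutionBounds_sum_inv_mul_succ_le_one (N : ℕ) :
    ∑ i ∈ Finset.Ico 1 N, (1 / ((i : ℝ) * ((i : ℝ) + 1))) ≤ 1 := by
  set f : ℕ → ℝ := fun k => 1 / ((k : ℝ) + 1) with hf
  have hle : ∀ k ∈ Finset.range (N - 1),
      (1 / (((1 + k : ℕ) : ℝ) * (((1 + k : ℕ) : ℝ) + 1))) ≤ f k - f (k + 1) := by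
    intro k _
    simp only [hf]
    push_cast
    have hk : (0 : ℝ) ≤ k := Nat.cast_nonneg k
    rw [div_sub_div _ _ (by positivity) (by positivity),
      div_le_div_iff₀ (by positivity) (by positivity)]
    nlinarith
  calc ∑ i ∈ Finset.Ico 1 N, (1 / ((i : ℝ) * ((i : ℝ) + 1)))
      = ∑ k ∈ Finset.range (N - 1), (1 / (((1 + k : ℕ) : ℝ) * (((1 + k : ℕ) : ℝ) + 1))) :=
        Finset.sum_Ico_eq_sum_range _ 1 N
    _ ≤ ∑ k ∈ Finset.range (N - 1), (f k - f (k + 1)) := Finset.sum_le_sum hle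
    _ = f 0 - f (N - 1) := Finset.sum_range_sub' f (N - 1)
    _ ≤ 1 := by
        have h0 : f 0 = 1 := by simp [hf]
        have hN : 0 ≤ f (N - 1) := by simp only [hf]; positivity
        linarith

/-! ### Reflection `i ↦ m − i` -/

/-- Reflection of a sum over `1 ≤ i < m` (real form of the substitution `i ↦ m − i`). -/
theorem convolutionBounds_sum_reflect (F : ℝ → ℝ) (m : ℕ) :
    ∑ i ∈ Finset.Ico 1 m, F ((m : ℝ) - (i : ℝ)) = ∑ i ∈ Finset.Ico 1 m, F (i : ℝ) := by
  have h := Finset.sum_Ico_reflect (fun j : ℕ => F (j : ℝ)) 1 (Nat.le_succ m)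
  rw [show m + 1 - m = 1 by omega, show m + 1 - 1 = m by omega] at h
  rw [← h]
  refine Finset.sum_congr rfl (fun i hi => ?_)
  rw [Finset.mem_Ico] at hi
  rw [Nat.cast_sub hi.2.le]

/-- Reflection of a sum over `2 ≤ i < m`: it becomes a sum over `1 ≤ j < m − 1`. -/
theorem convolutionBounds_sum_reflect_two (F : ℝ → ℝ) (m : ℕ) :
    ∑ i ∈ Finset.Ico 2 m, F ((m : ℝ) - (i : ℝ)) = ∑ i ∈ Finset.Ico 1 (m + 1 - 2), F (i : ℝ) := by
  have h := Finset.sum_Ico_reflect (fun j : ℕ => F (j : ℝ)) 2 (Nat.le_succ m)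
  rw [show m + 1 - m = 1 by omega] at h
  rw [← h]
  refine Finset.sum_congr rfl (fun i hi => ?_)
  rw [Finset.mem_Ico] at hi
  rw [Nat.cast_sub hi.2.le]

/-! ### The logarithmic telescoping bound for `Σ 1/(i(L+i))` -/

/-- One step of the logarithmic telescoping: for `L > 0` and `y > 0`,
`1/((y+1)(L+y+1)) ≤ (1/L)·[(log(y+1) − log(L+y+1)) − (log y − log(L+y))]`. -/
theorem convolutionBounds_omega_log_step {L y : ℝ} (hL : 0 < L) (hy : 0 < y) :
    1 / ((y + 1) * (L + (y + 1)))
      ≤ 1 / L * (Real.log (y + 1) - Real.log (L + (y + 1)))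
        - 1 / L * (Real.log y - Real.log (L + y)) := by
  -- with `Q := (y+1)(L+y) / (y (L+y+1)) > 1`: `1 − 1/Q = L/((y+1)(L+y)) ≥ L/((y+1)(L+y+1))`
  have hQ : 0 < (y + 1) * (L + y) / (y * (L + (y + 1))) := by positivity
  have hlog := Real.one_sub_inv_le_log_of_pos hQ
  rw [Real.log_div (by positivity) (by positivity), Real.log_mul (by positivity) (by positivity),
    Real.log_mul (by positivity) (by positivity)] at hlog
  have hinv : 1 - ((y + 1) * (L + y) / (y * (L + (y + 1))))⁻¹ = L / ((y + 1) * (L + y)) := by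
    field_simp
    ring
  rw [hinv] at hlog
  have hmono : 1 / ((y + 1) * (L + (y + 1))) ≤ 1 / L * (L / ((y + 1) * (L + y))) := by
    rw [show 1 / L * (L / ((y + 1) * (L + y))) = 1 / ((y + 1) * (L + y)) by field_simp]
    apply one_div_le_one_div_of_le (by positivity)
    nlinarith
  calc 1 / ((y + 1) * (L + (y + 1))) ≤ 1 / L * (L / ((y + 1) * (L + y))) := hmono
    _ ≤ 1 / L * (Real.log (y + 1) + Real.log (L + y) - (Real.log y + Real.log (L + (y + 1)))) := by
        gcongr
    _ = _ := by ring

/-- `Σ_{i=1}^{m−1} 1/(i(L+i)) ≤ 1/(L+1) + log(L+1)/L` for `L > 0`. -/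
theorem convolutionBounds_sum_omega_le (L : ℝ) (hL : 0 < L) (m : ℕ) :
    ∑ i ∈ Finset.Ico 1 m, (1 / ((i : ℝ) * (L + (i : ℝ))))
      ≤ 1 / (L + 1) + Real.log (L + 1) / L := by
  -- the telescoped bound for `m = M + 2 ≥ 2`
  have main : ∀ M : ℕ, ∑ i ∈ Finset.Ico 1 (M + 2), (1 / ((i : ℝ) * (L + (i : ℝ))))
      ≤ 1 / (L + 1) + 1 / L * (Real.log ((M : ℝ) + 1) - Real.log (L + ((M : ℝ) + 1)))
          + Real.log (L + 1) / L := by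
    intro M
    induction M with
    | zero =>
        rw [show (0 + 2 : ℕ) = 1 + 1 from rfl, Finset.sum_Ico_succ_top (le_refl 1),
          Finset.Ico_self, Finset.sum_empty]
        simp only [Nat.cast_zero, Nat.cast_one, zero_add, one_mul, Real.log_one, zero_sub]
        have : 1 / L * (-Real.log (L + 1)) + Real.log (L + 1) / L = 0 := by ring
        linarith
    | succ M ih =>
        rw [show M + 1 + 2 = (M + 2) + 1 by ring, Finset.sum_Ico_succ_top (by omega : 1 ≤ M + 2)]
        have hstep := convolutionBounds_omega_log_step hL (y := (M : ℝ) + 1) (by positivity)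
        push_cast
        rw [show (M : ℝ) + 2 = (M : ℝ) + 1 + 1 by ring]
        linarith [hstep, ih]
  rcases Nat.lt_or_ge m 2 with hm | hm
  · -- empty or trivial range
    interval_cases m
    · simp only [show Finset.Ico 1 0 = ∅ from rfl, Finset.sum_empty]
      have : 0 ≤ Real.log (L + 1) := Real.log_nonneg (by linarith)
      positivity
    · simp only [Finset.Ico_self, Finset.sum_empty]
      have : 0 ≤ Real.log (L + 1) := Real.log_nonneg (by linarith)
      positivity
  · obtain ⟨M, rfl⟩ : ∃ M, m = M + 2 := ⟨m - 2, by omega⟩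
    have h := main M
    have hneg : Real.log ((M : ℝ) + 1) - Real.log (L + ((M : ℝ) + 1)) ≤ 0 := by
      have : Real.log ((M : ℝ) + 1) ≤ Real.log (L + ((M : ℝ) + 1)) :=
        Real.log_le_log (by positivity) (by linarith)
      linarith
    have : 1 / L * (Real.log ((M : ℝ) + 1) - Real.log (L + ((M : ℝ) + 1))) ≤ 0 :=
      mul_nonpos_of_nonneg_of_nonpos (by positivity) hneg
    linarith

/-- `Σ_{1 ≤ j < N} ω(j) ≤ 1`, since `ω(j) = 1/(j(L+j)) ≤ 1/(j(j+1))` for `L ≥ 1`. -/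
theorem convolutionBounds_sum_omega_le_one (L : ℝ) (hL : 3 ≤ L) (N : ℕ) :
    ∑ i ∈ Finset.Ico 1 N, (1 / ((i : ℝ) * (L + (i : ℝ)))) ≤ 1 := by
  calc ∑ i ∈ Finset.Ico 1 N, (1 / ((i : ℝ) * (L + (i : ℝ))))
      ≤ ∑ i ∈ Finset.Ico 1 N, (1 / ((i : ℝ) * ((i : ℝ) + 1))) := by
        apply Finset.sum_le_sum
        intro i hi
        rw [Finset.mem_Ico] at hi
        have hi1 : (1 : ℝ) ≤ i := by exact_mod_cast hi.1
        apply one_div_le_one_div_of_le (by positivity)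
        nlinarith
    _ ≤ 1 := convolutionBounds_sum_inv_mul_succ_le_one _

/-! ### (CV4) -/

/-- (CV4), one summand: `i⁻²/(L+n−i) ≤ (1/(L+n))·i⁻² + (3/4)/(L+n)²` for `2 ≤ i ≤ n − 1`,
from `1/(L+n−i) = (1/(L+n))(1 + i/(L+n−i))` and `i(L+n−i) ≥ (4/3)(L+n)`. -/
theorem convolutionBounds_cv4_term {L n i : ℝ} (hL : 3 ≤ L) (hi : 2 ≤ i) (hin : i + 1 ≤ n) :
    1 / i ^ 2 * (1 / (L + (n - i))) ≤ 1 / (L + n) * (1 / i ^ 2) + (3 / 4) / (L + n) ^ 2 := by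
  have hi0 : 0 < i := by linarith
  have hn0 : 0 < n := by linarith
  have hp : 0 < L + (n - i) := by linarith
  have hLn : 0 < L + n := by linarith
  have key : 1 / i ^ 2 * (1 / (L + (n - i)))
      = 1 / (L + n) * (1 / i ^ 2) + 1 / (L + n) * (1 / (i * (L + (n - i)))) := by
    field_simp
    ring
  have hb : 1 / (i * (L + (n - i))) ≤ (3 / 4) / (L + n) := by
    rw [div_le_div_iff₀ (by positivity) hLn]
    nlinarith [mul_nonneg (by linarith : (0:ℝ) ≤ 3 * i - 6) (by linarith : (0:ℝ) ≤ L + (n - i) - 4)]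
  rw [key]
  have : 1 / (L + n) * (1 / (i * (L + (n - i)))) ≤ (3 / 4) / (L + n) ^ 2 := by
    calc 1 / (L + n) * (1 / (i * (L + (n - i)))) ≤ 1 / (L + n) * ((3 / 4) / (L + n)) := by
          gcongr
      _ = (3 / 4) / (L + n) ^ 2 := by rw [div_mul_div_comm, one_mul, sq]
  linarith

/-- (CV4) with real subtraction: `Σ_{i=2}^{n−1} i⁻²/(L+n−i) ≤ 3/(L+n)` (`L ≥ 3`, `n ≥ 2`). -/
theorem convolutionBounds_cv4_real (L : ℝ) (hL : 3 ≤ L) (n : ℕ) (hn : 2 ≤ n) :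
    ∑ i ∈ Finset.Ico 2 n, (1 / ((i : ℝ) ^ 2)) * (1 / (L + ((n : ℝ) - (i : ℝ)))) ≤ 3 / (L + n) := by
  have hn' : (2 : ℝ) ≤ n := by exact_mod_cast hn
  have hLn : 0 < L + n := by linarith
  have hS := convolutionBounds_sum_inv_sq_le_one n
  calc ∑ i ∈ Finset.Ico 2 n, (1 / ((i : ℝ) ^ 2)) * (1 / (L + ((n : ℝ) - (i : ℝ))))
      ≤ ∑ i ∈ Finset.Ico 2 n, (1 / (L + n) * (1 / (i : ℝ) ^ 2) + (3 / 4) / (L + n) ^ 2) := by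
        apply Finset.sum_le_sum
        intro i hi
        rw [Finset.mem_Ico] at hi
        exact convolutionBounds_cv4_term hL (by exact_mod_cast hi.1)
          (by exact_mod_cast Nat.succ_le_of_lt hi.2)
    _ = 1 / (L + n) * ∑ i ∈ Finset.Ico 2 n, (1 / (i : ℝ) ^ 2)
          + ((n - 2 : ℕ) : ℝ) * ((3 / 4) / (L + n) ^ 2) := by
        rw [Finset.sum_add_distrib, Finset.mul_sum, Finset.sum_const, Nat.card_Ico, nsmul_eq_mul]
    _ ≤ 1 / (L + n) * 1 + (3 / 4) / (L + n) := by
        have h1 : 1 / (L + n) * ∑ i ∈ Finset.Ico 2 n, (1 / (i : ℝ) ^ 2) ≤ 1 / (L + n) * 1 := by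
          gcongr
        have h2 : ((n - 2 : ℕ) : ℝ) * ((3 / 4) / (L + n) ^ 2) ≤ (3 / 4) / (L + n) := by
          rw [Nat.cast_sub hn]
          push_cast
          calc ((n : ℝ) - 2) * ((3 / 4) / (L + n) ^ 2)
              ≤ (L + n) * ((3 / 4) / (L + n) ^ 2) := by gcongr; linarith
            _ = (3 / 4) / (L + n) := by field_simp
        linarith
    _ = (7 / 4) / (L + n) := by ring
    _ ≤ 3 / (L + n) := div_le_div_of_nonneg_right (by norm_num) hLn.le

/-- (CV4) as registered: `Σ_{i=2}^{n−1} i⁻²/(2λ−1+(n−i)) ≤ 3/(2λ−1+n)` for real `λ ≥ 2`, `n ≥ 2`. -/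
theorem convolutionBounds_cv4 (lam : ℝ) (n : ℕ) (hlam : 2 ≤ lam) (hn : 2 ≤ n) :
    ∑ i ∈ Finset.Ico 2 n, (1 / ((i : ℝ) ^ 2)) * (1 / (2 * lam - 1 + ((n - i : ℕ) : ℝ)))
      ≤ 3 / (2 * lam - 1 + n) := by
  have hcast : ∑ i ∈ Finset.Ico 2 n, (1 / ((i : ℝ) ^ 2)) * (1 / (2 * lam - 1 + ((n - i : ℕ) : ℝ)))
      = ∑ i ∈ Finset.Ico 2 n, (1 / ((i : ℝ) ^ 2)) * (1 / (2 * lam - 1 + ((n : ℝ) - (i : ℝ)))) := by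
    refine Finset.sum_congr rfl (fun i hi => ?_)
    rw [Finset.mem_Ico] at hi
    rw [Nat.cast_sub hi.2.le]
  rw [hcast]
  exact convolutionBounds_cv4_real (2 * lam - 1) (by linarith) n hn

/-! ### (CV3) -/

/-- (CV3), splitting of one summand: `i⁻¹ ω(n−i) = (1/n)(1/(i(L+n−i)) + ω(n−i))`. -/
theorem convolutionBounds_cv3_term {L n i : ℝ} (hL : 3 ≤ L) (hi : 1 ≤ i) (hin : i + 1 ≤ n) :
    1 / i * (1 / ((n - i) * (L + (n - i))))
      = 1 / n * (1 / (i * (L + (n - i)))) + 1 / n * (1 / ((n - i) * (L + (n - i)))) := by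
  have hi0 : 0 < i := by linarith
  have hni : 0 < n - i := by linarith
  have hp : 0 < L + (n - i) := by linarith
  have hn0 : 0 < n := by linarith
  field_simp
  ring

/-- `1/(i(L+n−i)) ≤ 1/n` for `1 ≤ i ≤ n − 1`, `L ≥ 3` (the product is at least `L + n − 1`). -/
theorem convolutionBounds_inv_mul_le_inv {L n i : ℝ} (hL : 3 ≤ L) (hi : 1 ≤ i) (hin : i + 1 ≤ n) :
    1 / (i * (L + (n - i))) ≤ 1 / n := by
  apply one_div_le_one_div_of_le (by linarith)
  nlinarith [mul_nonneg (by linarith : (0:ℝ) ≤ i - 1) (by linarith : (0:ℝ) ≤ L + (n - i) - 1)]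

/-- (CV3) with real subtraction: `n Σ_{i=1}^{n−1} i⁻¹ ω(n−i) ≤ 4` (`L ≥ 3`, `n ≥ 1`); in fact `≤ 2`. -/
theorem convolutionBounds_cv3_real (L : ℝ) (hL : 3 ≤ L) (n : ℕ) (hn : 1 ≤ n) :
    (n : ℝ) * ∑ i ∈ Finset.Ico 1 n, (1 / (i : ℝ))
        * (1 / (((n : ℝ) - (i : ℝ)) * (L + ((n : ℝ) - (i : ℝ))))) ≤ 4 := by
  have hn' : (1 : ℝ) ≤ n := by exact_mod_cast hn
  have hn0 : (0 : ℝ) < n := by linarith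
  have hsplit : ∑ i ∈ Finset.Ico 1 n, (1 / (i : ℝ))
        * (1 / (((n : ℝ) - (i : ℝ)) * (L + ((n : ℝ) - (i : ℝ)))))
      = 1 / (n : ℝ) * ∑ i ∈ Finset.Ico 1 n, (1 / ((i : ℝ) * (L + ((n : ℝ) - (i : ℝ)))))
        + 1 / (n : ℝ)
          * ∑ i ∈ Finset.Ico 1 n, (1 / (((n : ℝ) - (i : ℝ)) * (L + ((n : ℝ) - (i : ℝ))))) := by
    rw [Finset.mul_sum, Finset.mul_sum, ← Finset.sum_add_distrib]
    refine Finset.sum_congr rfl (fun i hi => ?_)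
    rw [Finset.mem_Ico] at hi
    exact convolutionBounds_cv3_term hL (by exact_mod_cast hi.1)
      (by exact_mod_cast Nat.succ_le_of_lt hi.2)
  have h1 : ∑ i ∈ Finset.Ico 1 n, (1 / ((i : ℝ) * (L + ((n : ℝ) - (i : ℝ))))) ≤ 1 := by
    calc ∑ i ∈ Finset.Ico 1 n, (1 / ((i : ℝ) * (L + ((n : ℝ) - (i : ℝ)))))
        ≤ ∑ i ∈ Finset.Ico 1 n, (1 / (n : ℝ)) := by
          apply Finset.sum_le_sum
          intro i hi
          rw [Finset.mem_Ico] at hi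
          exact convolutionBounds_inv_mul_le_inv hL (by exact_mod_cast hi.1)
            (by exact_mod_cast Nat.succ_le_of_lt hi.2)
      _ = ((n - 1 : ℕ) : ℝ) * (1 / n) := by rw [Finset.sum_const, Nat.card_Ico, nsmul_eq_mul]
      _ ≤ (n : ℝ) * (1 / n) := by gcongr; exact_mod_cast Nat.sub_le n 1
      _ = 1 := by field_simp
  have h2 : ∑ i ∈ Finset.Ico 1 n, (1 / (((n : ℝ) - (i : ℝ)) * (L + ((n : ℝ) - (i : ℝ))))) ≤ 1 := by
    rw [convolutionBounds_sum_reflect (fun x => 1 / (x * (L + x))) n]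
    exact convolutionBounds_sum_omega_le_one L hL _
  rw [hsplit, mul_add, ← mul_assoc, ← mul_assoc, mul_one_div_cancel hn0.ne', one_mul, one_mul]
  linarith

/-- (CV3) as registered. -/
theorem convolutionBounds_cv3 (lam : ℝ) (n : ℕ) (hlam : 2 ≤ lam) (hn : 1 ≤ n) :
    (n : ℝ) * ∑ i ∈ Finset.Ico 1 n, (1 / (i : ℝ))
        * (1 / ((((n - i : ℕ) : ℝ)) * (2 * lam - 1 + ((n - i : ℕ) : ℝ)))) ≤ 4 := by
  have hcast : ∑ i ∈ Finset.Ico 1 n, (1 / (i : ℝ))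
        * (1 / ((((n - i : ℕ) : ℝ)) * (2 * lam - 1 + ((n - i : ℕ) : ℝ))))
      = ∑ i ∈ Finset.Ico 1 n, (1 / (i : ℝ))
        * (1 / (((n : ℝ) - (i : ℝ)) * (2 * lam - 1 + ((n : ℝ) - (i : ℝ))))) := by
    refine Finset.sum_congr rfl (fun i hi => ?_)
    rw [Finset.mem_Ico] at hi
    rw [Nat.cast_sub hi.2.le]
  rw [hcast]
  exact convolutionBounds_cv3_real (2 * lam - 1) (by linarith) n hn

/-! ### The registered sub-goal of part 1 -/

/-- Registered sub-goal `convolutionBounds_small` of `stub_convolutionBounds` (verbatim signature):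
the conjunction (CV3) ∧ (CV4). -/
theorem convolutionBounds_small :
    (∀ (lam : ℝ) (n : ℕ), 2 ≤ lam → 1 ≤ n →
        (n : ℝ) * ∑ i ∈ Finset.Ico 1 n, (1 / (i : ℝ))
          * (1 / ((((n - i : ℕ) : ℝ)) * (2 * lam - 1 + ((n - i : ℕ) : ℝ)))) ≤ 4) ∧
    (∀ (lam : ℝ) (n : ℕ), 2 ≤ lam → 2 ≤ n →
        ∑ i ∈ Finset.Ico 2 n, (1 / ((i : ℝ) ^ 2)) * (1 / (2 * lam - 1 + ((n - i : ℕ) : ℝ)))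
          ≤ 3 / (2 * lam - 1 + n)) :=
  ⟨convolutionBounds_cv3, convolutionBounds_cv4⟩

end Summit.FinalStateConjecture.FinalStateConjecture.Theorems.CrumPeelingRecessiveTower

end
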